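import Summits.Langlands.Langlands.Statement
import Summits.Langlands.Langlands.Theorems.SoloBlindUniqueness
import HarnessLib

/-!
# `Langlands`: the quantifier `∀ 𝓡` reduces to one datum plus local agreement

Summit `Langlands` (`Summits/Langlands/Langlands/Statement`) asserts global reciprocity for
`GL_n` over every number field `F` **relative to every reciprocity datum**
`𝓡 : Summit.Langlands.ReciprocityData F` — a Henniart-pinned local Langlands datum
`𝓡.llc v : LocalLanglandsDatum (F_v)` at every finite place (`recGL`, bijective, `GL_1` = local class
field theory against THE Artin map, `L`/`ε` of pairs for GENERIC pairs `m < n`, twists, central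
characters: the accepted property `IsLocalLanglandsGL`).  The datum enters the statement at exactly
one point: the class `(𝓡.llc v).recGL n [π_v]` of the local component `π_v` of the cuspidal `π` in
`LocalGlobalCompatibleAt`; the `p`-adic Hodge datum `𝓡.pst` is Fontaine's pinned one and does not
depend on `𝓡` (definitionally).

The accepted `IsLocalLanglandsGL` deliberately does NOT assert that its properties pin `rec_n`
(module docstring of `LocalLanglandsGL`, "Uniqueness (why not `∃!`)": non-generic classes are not
constrained; the tree records uniqueness only on supercuspidal classes, as the named fact
`IsLocalLanglandsGL.unique_of_isSupercuspidal`, Henniart 1993).  Hence, as typed, a proof of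
`Langlands` owes local–global compatibility against EVERY admissible family `rec` simultaneously.

This file proves, unconditionally, the bookkeeping half of that observation:

* `SoloBlind.corresponds_of_recGL_eq` — if two data `𝓡, 𝓡'` give the same class to every local
  component of `π`, then `Corresponds 𝓡 ι π ρ → Corresponds 𝓡' ι π ρ`;
* `SoloBlind.globalLanglandsCorrespondenceGLn_of_recGL_eq` — reciprocity (both directions, with the
  uniqueness clause) transfers from `𝓡` to any `𝓡'` agreeing with `𝓡` on the local components of the
  L-algebraic cuspidal `π` of `GL_n(𝔸_K)`;
* `SoloBlind.langlands_of_one_datum` — **it suffices to prove**: (i) non-vacuity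
  `Nonempty (ReciprocityData F)`; (ii) for each `F, n, hcpt` reciprocity WITHOUT the uniqueness
  clause for ONE datum `𝓡₀` (by `SoloBlind.langlands_iff_langlandsExists` the uniqueness clause is
  free); (iii) LOCAL AGREEMENT: any two pinned data give the same class to every local component of
  every L-algebraic cuspidal `π`.

In print (iii) is a theorem of the local theory alone: local components of cuspidal automorphic
representations of `GL_n` are generic (Shalika 1974, Thm. 5.5 with the Fourier expansion of cusp
forms; Piatetski-Shapiro 1979), and two families with the `IsLocalLanglandsGL` properties agree on
generic classes by Henniart's characterisation through `γ`-factors of pairs with all generic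
representations of `GL_m`, `m ≤ n - 1` (Henniart 1993, Thm. 1.1; sharpened to `m ≤ [n/2]` by
Jacquet–Liu 2018, Thm. 1.3) together with the `L`-factor bookkeeping of Jacquet–Piatetski-Shapiro–
Shalika 1983 on the Weil–Deligne side.  None of this is in the tree; the present file isolates it as
the exact extra load the quantifier `∀ 𝓡` puts on a proof of the summit.  (If, contrary to the
printed theorems, two pinned data could differ on a generic class occurring as a local component of
an L-algebraic cusp form, the summit as typed would be refutable; the converse bookkeeping —
`Langlands` implies local agreement — needs the independence-of-choices fact
`IsWeilDeligneOfLadic.isEquivalent` and is not attempted here.)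

## References

* G. Henniart, *Caractérisation de la correspondance de Langlands locale par les facteurs ε de
  paires*, Invent. Math. 113 (1993), Thm. 1.1. [Henniart1993]
* H. Jacquet, B. Liu, *On the local converse theorem for p-adic GL_n*, Amer. J. Math. 140 (2018),
  Thm. 1.3 (arXiv:1601.03656, p. 3). [JacquetLiuAJM2018]
* J. A. Shalika, *The multiplicity one theorem for GL_n*, Ann. of Math. 100 (1974), §5.
  [Shalika1974]
* M. Harris, R. Taylor, *The geometry and cohomology of some simple Shimura varieties*, Ann. of
  Math. Stud. 151 (2001), Introduction pp. 2–4 (properties 1–5 of `rec_K`; "Henniart showed that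
  there is at most one set of bijections `rec_K` with these properties"). [HarrisTaylorAMS2001]
-/

open scoped MatrixGroups Matrix Classical NumberField
open NumberField IsDedekindDomain Filter
open Literature.NumberTheory.Automorphic Literature.NumberTheory.GaloisRepresentations

noncomputable section

namespace Summit.Langlands.Langlands.Theorems

namespace SoloBlind

variable {n : ℕ} {K : Type} [Field K] [NumberField K] {hcpt : isCompact_glFiniteIntegralLevel n K}
  {ℓ : ℕ} [Fact ℓ.Prime]

/-! ## The `p`-adic Hodge side does not see `𝓡` -/

/-- The pinned Fontaine datum of a reciprocity datum is Fontaine's, whatever the datum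
(definitional). [folklore] -/
theorem pst_eq (𝓡 𝓡' : ReciprocityData K) : 𝓡.pst = 𝓡'.pst := rfl

/-! ## Transfer of the correspondence along local agreement -/

/-- **Local–global compatibility at `v` transfers** from `𝓡` to `𝓡'` as soon as the two data give
the same class `rec_v(π_v)` to every local component `π_v` of `π` at `v` (the datum enters
`LocalGlobalCompatibleAt` only through that class; `𝓡.pst` is pinned).
[cite: HarrisTaylorAMS2001, Thm. A] -/
theorem localGlobalCompatibleAt_of_recGL_eq {𝓡 𝓡' : ReciprocityData K} {ι : PadicAlgCl ℓ ≃+* ℂ}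
    {π : AutomorphicRepData (AutomorphyDatum.gl n K hcpt)} {ρ : FramedGaloisRep K (PadicAlgCl ℓ) n}
    {v : HeightOneSpectrum (𝓞 K)}
    (hagree : ∀ πv : SmoothIrrep (GL (Fin n) (v.adicCompletion K)), π.HasLocalComponentAt v πv.ρ →
      (𝓡.llc v).recGL n (IrrClass.mk πv) = (𝓡'.llc v).recGL n (IrrClass.mk πv))
    (h : LocalGlobalCompatibleAt 𝓡 ι π ρ v) : LocalGlobalCompatibleAt 𝓡' ι π ρ v := by
  obtain ⟨πv, r, rℂ, hloc, hlad, hpst, htr, hcl⟩ := h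
  exact ⟨πv, r, rℂ, hloc, hlad, hpst, htr, hagree πv hloc ▸ hcl⟩

/-- **`Corresponds` transfers** from `𝓡` to `𝓡'` along agreement of the two data on the local
components of `π` (the Satake clause does not mention the datum).
[cite: BuzzardGeeLMS2014, Conj. 3.2.1–3.2.2] -/
theorem corresponds_of_recGL_eq {𝓡 𝓡' : ReciprocityData K} {ι : PadicAlgCl ℓ ≃+* ℂ}
    {π : AutomorphicRepData (AutomorphyDatum.gl n K hcpt)} {ρ : FramedGaloisRep K (PadicAlgCl ℓ) n}
    (hagree : ∀ (v : HeightOneSpectrum (𝓞 K)) (πv : SmoothIrrep (GL (Fin n) (v.adicCompletion K))),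
      π.HasLocalComponentAt v πv.ρ →
        (𝓡.llc v).recGL n (IrrClass.mk πv) = (𝓡'.llc v).recGL n (IrrClass.mk πv))
    (h : Corresponds 𝓡 ι π ρ) : Corresponds 𝓡' ι π ρ :=
  ⟨h.1, fun v ↦ localGlobalCompatibleAt_of_recGL_eq (hagree v) (h.2 v)⟩

variable (n) in
/-- **Direction (A) transfers** from `𝓡` to any `𝓡'` agreeing with `𝓡` on the local components of
the L-algebraic cuspidal `π` of `GL_n(𝔸_K)` — including the uniqueness clause (transfer `𝓡' → 𝓡` of
the competitor `ρ'`, then uniqueness for `𝓡`). [cite: BuzzardGeeLMS2014, Conj. 3.2.2] -/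
theorem automorphicToGalois_of_recGL_eq {𝓡 𝓡' : ReciprocityData K}
    (hagree : ∀ π : CuspidalAutomorphicRepData n K hcpt, π.1.IsLAlgebraic →
      ∀ (v : HeightOneSpectrum (𝓞 K)) (πv : SmoothIrrep (GL (Fin n) (v.adicCompletion K))),
        π.1.HasLocalComponentAt v πv.ρ →
          (𝓡.llc v).recGL n (IrrClass.mk πv) = (𝓡'.llc v).recGL n (IrrClass.mk πv))
    (h : AutomorphicToGalois n 𝓡 hcpt) : AutomorphicToGalois n 𝓡' hcpt := by
  intro π hπ ℓ _ ι
  obtain ⟨ρ, hirr, hgeo, hc, huniq⟩ := h π hπ ℓ ι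
  refine ⟨ρ, hirr, hgeo, corresponds_of_recGL_eq (hagree π hπ) hc, fun ρ' hc' ↦ huniq ρ' ?_⟩
  exact corresponds_of_recGL_eq (fun v πv hv ↦ (hagree π hπ v πv hv).symm) hc'

variable (n) in
/-- **Direction (B) transfers** from `𝓡` to any `𝓡'` agreeing with `𝓡` on the local components of
the L-algebraic cuspidal `π` of `GL_n(𝔸_K)` (geometricity is datum-free).
[cite: FontaineMazurGeometric1995, Conj. 1] -/
theorem galoisToAutomorphic_of_recGL_eq {𝓡 𝓡' : ReciprocityData K}
    (hagree : ∀ π : CuspidalAutomorphicRepData n K hcpt, π.1.IsLAlgebraic →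
      ∀ (v : HeightOneSpectrum (𝓞 K)) (πv : SmoothIrrep (GL (Fin n) (v.adicCompletion K))),
        π.1.HasLocalComponentAt v πv.ρ →
          (𝓡.llc v).recGL n (IrrClass.mk πv) = (𝓡'.llc v).recGL n (IrrClass.mk πv))
    (h : GaloisToAutomorphic n 𝓡 hcpt) : GaloisToAutomorphic n 𝓡' hcpt := by
  intro ℓ _ ι ρ hirr hgeo
  obtain ⟨π, hπ, hc⟩ := h ℓ ι ρ hirr hgeo
  exact ⟨π, hπ, corresponds_of_recGL_eq (hagree π hπ) hc⟩

variable (n K) in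
/-- **Reciprocity for `GL_n` over `K` transfers** from one datum to any datum agreeing with it on
the local components of the L-algebraic cuspidal `π`. [cite: BuzzardGeeLMS2014, Conj. 3.2.2] -/
theorem globalLanglandsCorrespondenceGLn_of_recGL_eq {𝓡 𝓡' : ReciprocityData K}
    (hagree : ∀ π : CuspidalAutomorphicRepData n K hcpt, π.1.IsLAlgebraic →
      ∀ (v : HeightOneSpectrum (𝓞 K)) (πv : SmoothIrrep (GL (Fin n) (v.adicCompletion K))),
        π.1.HasLocalComponentAt v πv.ρ →
          (𝓡.llc v).recGL n (IrrClass.mk πv) = (𝓡'.llc v).recGL n (IrrClass.mk πv))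
    (h : GlobalLanglandsCorrespondenceGLn n K 𝓡 hcpt) : GlobalLanglandsCorrespondenceGLn n K 𝓡' hcpt :=
  ⟨automorphicToGalois_of_recGL_eq n hagree h.1, galoisToAutomorphic_of_recGL_eq n hagree h.2⟩

/-! ## What suffices for the summit -/

/-- **It suffices, for `Langlands`, to prove**: for every number field `F`, (i) a pinned
reciprocity datum exists; (iii) LOCAL AGREEMENT — any two pinned data give the same class to every
local component of every L-algebraic cuspidal `π` of `GL_n(𝔸_F)` (in print: genericity of local
components, Shalika 1974, and Henniart's 1993 characterisation of the local correspondence on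
generic classes; not in the tree); and (ii) for every `n ≥ 1` and `hcpt`, reciprocity in the
existence form (no uniqueness clause) for ONE datum `𝓡₀`.
[cite: Henniart1993, Thm. 1.1] [cite: Shalika1974, Thm. 5.5] [cite: BuzzardGeeLMS2014, Conj. 3.2.2] -/
theorem langlands_of_one_datum
    (h : ∀ (F : Type) [Field F] [NumberField F],
      Nonempty (Summit.Langlands.ReciprocityData F) ∧
      (∀ (𝓡 𝓡' : Summit.Langlands.ReciprocityData F) (n : ℕ)
          (hcpt : isCompact_glFiniteIntegralLevel n F) (π : CuspidalAutomorphicRepData n F hcpt),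
          π.1.IsLAlgebraic →
            ∀ (v : HeightOneSpectrum (𝓞 F)) (πv : SmoothIrrep (GL (Fin n) (v.adicCompletion F))),
              π.1.HasLocalComponentAt v πv.ρ →
                (𝓡.llc v).recGL n (IrrClass.mk πv) = (𝓡'.llc v).recGL n (IrrClass.mk πv)) ∧
      ∀ (n : ℕ), 0 < n → ∀ hcpt : isCompact_glFiniteIntegralLevel n F,
        ∃ 𝓡₀ : Summit.Langlands.ReciprocityData F,
          (∀ π : CuspidalAutomorphicRepData n F hcpt, π.1.IsLAlgebraic →
            ∀ (ℓ : ℕ) [Fact ℓ.Prime] (ι : PadicAlgCl ℓ ≃+* ℂ),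
              ∃ ρ : FramedGaloisRep F (PadicAlgCl ℓ) n,
                ρ.toGaloisRep.IsIrreducible ∧ IsGeometricFramed 𝓡₀ ρ ∧ Corresponds 𝓡₀ ι π.1 ρ) ∧
          GaloisToAutomorphic n 𝓡₀ hcpt) :
    Langlands := by
  refine langlands_of_exists fun F _ _ ↦ ⟨(h F).1, fun 𝓡 n hn hcpt ↦ ?_⟩
  obtain ⟨𝓡₀, hA, hB⟩ := (h F).2.2 n hn hcpt
  have hglc : GlobalLanglandsCorrespondenceGLn n F 𝓡 hcpt :=
    globalLanglandsCorrespondenceGLn_of_recGL_eq n F ((h F).2.1 𝓡₀ 𝓡 n hcpt)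
      ⟨(automorphicToGalois_iff_exists 𝓡₀ hcpt).2 hA, hB⟩
  exact ⟨(automorphicToGalois_iff_exists 𝓡 hcpt).1 hglc.1, hglc.2⟩

end SoloBlind

end Summit.Langlands.Langlands.Theorems

end
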